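import Summits.QuantumFields.YangMills.Theorems.FemtoTransferGapBounds
import Summits.QuantumFields.YangMills.Theorems.FemtoTransferGapPositivity
import Summits.QuantumFields.YangMills.Theorems.FemtoTransferGapReduction
import Mathlib.Analysis.SpecialFunctions.Log.Basic

/-!
# Crux RED, line «KTR», stub 3b′: LABEL LEMMAS — the bare one-site parameter at the natural coupling `L0³β`
# versus the two-loop running label `λ(β, L0)/L0`

Fleet-lead support module of seat ym-luscher-20007-p1 g3 for `stmt-QuantumFields-19978` (route `LuscherReduction`, crux RED
`RunningReduction`, line «KTR» rev 3, registered stub `stub_coarseNoIntruderAt2`).  Route-independent half (no `Theses` import) of the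
reduction `BO(L0) ∧ ONE ⇒ CoarseNoIntruderAt L0` carried out in `LuscherReductionRunningReductionBOHandover.lean`:

* `invRunningCoupling_eq` / `invRunningCoupling_le_half`: `1/ḡ²(β,L) = β/2 − 2b₀ log L + (b₁/b₀) log(2b₀/β) ≤ β/2` (`β ≥ 1`);
* `luscherLambda_pow_three`, `mul_bareLambda_pow_three`: `λ³ = ḡ²`, `(L0·bareLambda(L0³β))³ = 2/β`;
* `mul_bareLambda_le_luscherLambda`: `L0 · bareLambda(L0³β) ≤ luscherLambda β L0` whenever `β ≥ 1`, `λ > 0` (lower label bound);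
* `exists_luscherLambda_le_mul_bareLambda`: for every `η > 0`, eventually in `β`, `luscherLambda β L0 ≤ (1+η) · L0 · bareLambda(L0³β)`
  (upper label bound: the two-loop logarithms are `o(β)`, `Real.tendsto_pow_log_div_mul_add_atTop`);
* `beta_ge_of_window`: in the femto window at `L0`, `β ≥ 1/(4 lam³)`;
* exponent and threshold bookkeeping `exponent_upper_le`, `exponent_lower_le`, `le_of_small_lam`.

All proved; no definitions, no named facts.  HONEST FRAMING: elementary real analysis about the route's labels; femto rung R2b1 bookkeeping only.
-/

set_option autoImplicit false

noncomputable section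

open MeasureTheory Filter Topology Real
open Literature.MathematicalPhysics.QuantumFieldTheory
open Literature.MathematicalPhysics.QuantumLattice
open Literature.Analysis.OperatorTheory.YMMatrixModel

namespace Summit.QuantumFields.YangMills.Theorems.FemtoTransferGap

namespace BOHandover

/-! ## §1 Label lemmas: the bare parameter at the natural coupling `L0³β` versus the running label `λ(β, L0)/L0` -/

/-- `2 b₀ = 11/(12π²) ≤ 1`. [folklore] -/
theorem two_mul_b0_le_one : 2 * b0 ≤ 1 := by
  unfold b0
  have hπ : (3 : ℝ) < π := Real.pi_gt_three
  have hπ2 : (9 : ℝ) < π ^ 2 := by nlinarith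
  rw [show (2 : ℝ) * (11 / (24 * π ^ 2)) = 11 / (12 * π ^ 2) by ring]
  rw [div_le_one (by positivity)]
  nlinarith

/-- The explicit form of the two-loop inverse running coupling:
`1/ḡ²(β, L) = β/2 − 2b₀ log L + (b₁/b₀) log(2b₀/β)`. [cite: LuscherMunster1984, §2] -/
theorem invRunningCoupling_eq (β : ℝ) (L : ℕ) :
    invRunningCoupling β L = β / 2 - 2 * b0 * Real.log (L : ℝ) + (b1 / b0) * Real.log (2 * b0 / β) := by
  have hb0 : b0 ≠ 0 := by unfold b0; positivity
  unfold invRunningCoupling sizeLog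
  field_simp
  ring

/-- `1/ḡ²(β, L) ≤ β/2` for `β ≥ 1` and `L ≥ 1` (both logarithmic corrections are nonpositive there). [folklore] -/
theorem invRunningCoupling_le_half {β : ℝ} (hβ : 1 ≤ β) (L : ℕ) [NeZero L] :
    invRunningCoupling β L ≤ β / 2 := by
  rw [invRunningCoupling_eq]
  have hb0 : 0 < b0 := by unfold b0; positivity
  have hb1 : 0 < b1 := by unfold b1; positivity
  have hlogL : 0 ≤ Real.log (L : ℝ) := Real.log_nonneg (by exact_mod_cast NeZero.one_le)
  have hlog : Real.log (2 * b0 / β) ≤ 0 := by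
    apply Real.log_nonpos (by positivity)
    rw [div_le_one (by linarith)]
    exact two_mul_b0_le_one.trans hβ
  have h1 : 0 ≤ 2 * b0 * Real.log (L : ℝ) := by positivity
  have h2 : (b1 / b0) * Real.log (2 * b0 / β) ≤ 0 := mul_nonpos_of_nonneg_of_nonpos (div_pos hb1 hb0).le hlog
  linarith

/-- A positive running label forces a positive inverse running coupling (else `λ = 0^{−1/3} = 0`). [folklore] -/
theorem invRunningCoupling_pos_of_luscherLambda_pos {β : ℝ} {L : ℕ} (h : 0 < luscherLambda β L) :
    0 < invRunningCoupling β L := by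
  by_contra hle
  push Not at hle
  have : luscherLambda β L = 0 := by
    unfold luscherLambda
    rw [max_eq_right hle, Real.zero_rpow (by norm_num)]
  linarith

/-- `λ(β, L)³ = ḡ²(β, L) = (1/ḡ²)⁻¹` on the asymptotically free side. [cite: LuscherMunster1984, §2] -/
theorem luscherLambda_pow_three {β : ℝ} {L : ℕ} (h : 0 < invRunningCoupling β L) :
    luscherLambda β L ^ 3 = (invRunningCoupling β L)⁻¹ := by
  unfold luscherLambda
  rw [max_eq_left h.le, ← Real.rpow_natCast, ← Real.rpow_mul h.le]
  norm_num
  exact Real.rpow_neg_one _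

/-- `(L0 · λ_b(L0³β))³ = 2/β`: the bare parameter at the natural coupling is `(2/β)^{1/3}/L0`. [cite: Luscher1983, §3] -/
theorem mul_bareLambda_pow_three (L0 : ℕ) [NeZero L0] {β : ℝ} (hβ : 0 < β) :
    ((L0 : ℝ) * bareLambda ((L0 : ℝ) ^ 3 * β)) ^ 3 = 2 / β := by
  have hL0 : (0 : ℝ) < L0 := Nat.cast_pos.mpr (NeZero.pos L0)
  unfold bareLambda
  have h13 : ((1 : ℝ) / 3) = ((3 : ℕ) : ℝ)⁻¹ := by norm_num
  rw [mul_pow, h13, Real.rpow_inv_natCast_pow (by positivity) (by norm_num)]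
  field_simp

/-- The bare parameter at the natural coupling is positive for `β > 0`. [folklore] -/
theorem mul_bareLambda_pos (L0 : ℕ) [NeZero L0] {β : ℝ} (hβ : 0 < β) :
    0 < (L0 : ℝ) * bareLambda ((L0 : ℝ) ^ 3 * β) := by
  have hL0 : (0 : ℝ) < L0 := Nat.cast_pos.mpr (NeZero.pos L0)
  unfold bareLambda
  exact mul_pos hL0 (Real.rpow_pos_of_pos (by positivity) _)

/-- **Lower label bound**: in the weak-coupling regime the running label dominates the bare one,
`L0 · bareLambda(L0³β) ≤ luscherLambda β L0` (`β ≥ 1`, `λ > 0`), because `1/ḡ² ≤ β/2`. [cite: LuscherMunster1984, §2] -/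
theorem mul_bareLambda_le_luscherLambda {β : ℝ} (hβ : 1 ≤ β) (L0 : ℕ) [NeZero L0]
    (hl : 0 < luscherLambda β L0) :
    (L0 : ℝ) * bareLambda ((L0 : ℝ) ^ 3 * β) ≤ luscherLambda β L0 := by
  have hβ0 : 0 < β := by linarith
  have hinv : 0 < invRunningCoupling β L0 := invRunningCoupling_pos_of_luscherLambda_pos hl
  have hm := mul_bareLambda_pos L0 hβ0
  rw [← pow_le_pow_iff_left₀ hm.le hl.le (by norm_num : (3 : ℕ) ≠ 0), mul_bareLambda_pow_three L0 hβ0,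
    luscherLambda_pow_three hinv]
  rw [div_eq_mul_inv, show (2 : ℝ) * β⁻¹ = (β / 2)⁻¹ by rw [inv_div]; ring]
  exact inv_anti₀ hinv (invRunningCoupling_le_half hβ L0)

/-- In the window the bare coupling is large: `β ≥ 1/(4 lam³)` (`λ ≤ 2 lam` and `L0·λ_b(L0³β) = (2/β)^{1/3} ≤ λ`). [folklore] -/
theorem beta_ge_of_window {lam β : ℝ} {L0 : ℕ} [NeZero L0] (hlam : 0 < lam) (hw : InFemtoWindow lam β L0) :
    1 / (4 * lam ^ 3) ≤ β := by
  have hβ1 : 1 ≤ β := hw.1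
  have hβ0 : 0 < β := by linarith
  have hl : 0 < luscherLambda β L0 := luscherLambda_pos_of_window hlam hw
  have h1 := mul_bareLambda_le_luscherLambda hβ1 L0 hl
  have h2 : luscherLambda β L0 ≤ 2 * lam := hw.2.2
  have h3 : ((L0 : ℝ) * bareLambda ((L0 : ℝ) ^ 3 * β)) ^ 3 ≤ (2 * lam) ^ 3 :=
    pow_le_pow_left₀ (mul_bareLambda_pos L0 hβ0).le (h1.trans h2) 3
  rw [mul_bareLambda_pow_three L0 hβ0] at h3
  rw [div_le_iff₀ (by positivity)]
  rw [div_le_iff₀ hβ0] at h3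
  nlinarith

/-- **Upper label bound, eventually**: for every `η > 0` there is `β₁` with `luscherLambda β L0 ≤ (1+η) · L0 · bareLambda(L0³β)` for all
`β ≥ β₁` with `λ(β, L0) > 0` — the two-loop logarithms in `1/ḡ² = β/2 − 2b₀ log L0 − (b₁/b₀) log(β/(2b₀))` are `o(β)`.
[cite: LuscherMunster1984, §2] -/
theorem exists_luscherLambda_le_mul_bareLambda (L0 : ℕ) [NeZero L0] {η : ℝ} (hη : 0 < η) :
    ∃ β₁ : ℝ, ∀ β : ℝ, β₁ ≤ β → 0 < luscherLambda β L0 →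
      luscherLambda β L0 ≤ (1 + η) * ((L0 : ℝ) * bareLambda ((L0 : ℝ) ^ 3 * β)) := by
  have hb0 : 0 < b0 := by unfold b0; positivity
  have hb1 : 0 < b1 := by unfold b1; positivity
  -- the room `c β`, `c = (1 − (1+η)^{-3})/2 > 0`
  set q : ℝ := ((1 + η) ^ 3)⁻¹ with hq_def
  have hq1 : q < 1 := by
    rw [hq_def]; exact inv_lt_one_of_one_lt₀ (one_lt_pow₀ (by linarith : (1 : ℝ) < 1 + η) three_ne_zero)
  have hq0 : 0 < q := by rw [hq_def]; positivity
  set c : ℝ := (1 - q) / 2 with hc_def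
  have hc : 0 < c := by rw [hc_def]; linarith
  -- `log β / β → 0`
  have hlog : Tendsto (fun x : ℝ => Real.log x ^ 1 / (1 * x + 0)) atTop (𝓝 0) :=
    Real.tendsto_pow_log_div_mul_add_atTop 1 0 1 one_ne_zero
  have hK : 0 < b1 / b0 := div_pos hb1 hb0
  set K : ℝ := 2 * b0 * Real.log (L0 : ℝ) + (b1 / b0) * |Real.log (2 * b0)| with hK_def
  have hKnn : 0 ≤ K := by
    rw [hK_def]
    have : 0 ≤ Real.log (L0 : ℝ) := Real.log_nonneg (by exact_mod_cast NeZero.one_le)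
    positivity
  have hev1 : ∀ᶠ x : ℝ in atTop, Real.log x ^ 1 / (1 * x + 0) < c / (2 * (b1 / b0)) :=
    hlog.eventually (gt_mem_nhds (by positivity))
  have hev2 : ∀ᶠ x : ℝ in atTop, K ≤ c / 2 * x := by
    have : Tendsto (fun x : ℝ => c / 2 * x) atTop atTop := Tendsto.const_mul_atTop (by positivity) tendsto_id
    exact this.eventually_ge_atTop K
  have hev3 : ∀ᶠ x : ℝ in atTop, 1 ≤ x := eventually_ge_atTop 1
  obtain ⟨β₁, hβ₁⟩ := (hev1.and (hev2.and hev3)).exists_forall_of_atTop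
  refine ⟨β₁, fun β hβ hl => ?_⟩
  obtain ⟨h1, h2, h3⟩ := hβ₁ β hβ
  have hβ0 : 0 < β := by linarith
  have hinv : 0 < invRunningCoupling β L0 := invRunningCoupling_pos_of_luscherLambda_pos hl
  -- `log β ≤ (c/(2K')) β`
  have hlogβ : (b1 / b0) * Real.log β ≤ c / 2 * β := by
    have h1' : Real.log β / β < c / (2 * (b1 / b0)) := by simpa using h1
    rw [div_lt_iff₀ hβ0] at h1'
    have := mul_le_mul_of_nonneg_left h1'.le hK.le
    calc (b1 / b0) * Real.log β ≤ (b1 / b0) * (c / (2 * (b1 / b0)) * β) := this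
      _ = c / 2 * β := by field_simp
  -- hence `q β/2 ≤ invRunningCoupling β L0`
  have hmain : q * (β / 2) ≤ invRunningCoupling β L0 := by
    rw [invRunningCoupling_eq]
    have hsplit : Real.log (2 * b0 / β) = Real.log (2 * b0) - Real.log β := by
      rw [Real.log_div (by positivity) hβ0.ne']
    rw [hsplit]
    have habs : -( (b1 / b0) * |Real.log (2 * b0)|) ≤ (b1 / b0) * Real.log (2 * b0) := by
      have := neg_abs_le (Real.log (2 * b0))
      nlinarith
    have hq' : q * (β / 2) = β / 2 - c * β := by rw [hc_def]; ring
    rw [hq']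
    nlinarith [hlogβ, h2, habs, hKnn]
  -- compare cubes
  have hm := mul_bareLambda_pos L0 hβ0
  have hpos : 0 ≤ (1 + η) * ((L0 : ℝ) * bareLambda ((L0 : ℝ) ^ 3 * β)) := by positivity
  rw [← pow_le_pow_iff_left₀ hl.le hpos (by norm_num : (3 : ℕ) ≠ 0), mul_pow, mul_bareLambda_pow_three L0 hβ0,
    luscherLambda_pow_three hinv]
  -- `invRC⁻¹ ≤ (1+η)³ · 2/β` iff `β/(2(1+η)³) ≤ invRC`
  have hq2 : q * (β / 2) = ((1 + η) ^ 3 * (2 / β))⁻¹ := by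
    rw [hq_def]; field_simp
  rw [hq2] at hmain
  have hpos2 : 0 < (1 + η) ^ 3 * (2 / β) := by positivity
  exact (inv_le_comm₀ hinv hpos2).mpr hmain

/-! ## §1b Exponent and threshold bookkeeping -/

/-- Exponent bookkeeping for the upper direction: with `Δ = d + g`, `ε = g/4`, `|d| η ≤ g/4`, `C m ≤ g/2`, `0 ≤ m ≤ t ≤ (1+η) m`:
`ε m − (Δ m − C m²) ≤ −(d t)`. [folklore] -/
theorem exponent_upper_le {d g η C m t : ℝ} (hdη : |d| * η ≤ g / 4)
    (hCm : C * m ≤ g / 2) (hm : 0 ≤ m) (hmt : m ≤ t) (htm : t ≤ (1 + η) * m) :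
    g / 4 * m - ((d + g) * m - C * m ^ 2) ≤ -(d * t) := by
  -- `-(d t) ≥ -d m - |d| η m`
  have hkey : -(d * m) - |d| * η * m ≤ -(d * t) := by
    rcases le_or_gt 0 d with hd | hd
    · rw [abs_of_nonneg hd]
      nlinarith
    · rw [abs_of_neg hd]
      nlinarith
  have h2 : C * m ^ 2 ≤ g / 2 * m := by nlinarith
  nlinarith

/-- Exponent bookkeeping for the lower direction: with `0 ≤ Δ`, `0 < ε₀`, `C m ≤ ε₀/2`, `0 ≤ m ≤ t`:
`(Δ + ε₀) t ≥ Δ m + C m² + (ε₀/2) m`. [folklore] -/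
theorem exponent_lower_le {Δ ε₀ C m t : ℝ} (hΔ : 0 ≤ Δ) (hε : 0 < ε₀) (hCm : C * m ≤ ε₀ / 2)
    (hm : 0 ≤ m) (hmt : m ≤ t) :
    -((Δ + ε₀) * t) ≤ -(Δ * m + C * m ^ 2) - ε₀ / 2 * m := by
  have h2 : C * m ^ 2 ≤ ε₀ / 2 * m := by nlinarith
  nlinarith

/-- Threshold bookkeeping: if `lam ≤ 1`, `lam ≤ 1/(4M)` with `M ≥ 1`, then `1/(4 lam³) ≥ M`. [folklore] -/
theorem le_of_small_lam {lam M : ℝ} (hM : 1 ≤ M) (hlam : 0 < lam) (hlam1 : lam ≤ 1) (hleM : lam ≤ 1 / (4 * M)) :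
    M ≤ 1 / (4 * lam ^ 3) := by
  have hM0 : 0 < M := by linarith
  rw [le_div_iff₀ (by positivity)]
  have hlam3 : lam ^ 3 ≤ lam := pow_le_of_le_one hlam.le hlam1 three_ne_zero
  rw [le_div_iff₀ (by positivity)] at hleM
  nlinarith

end BOHandover

end Summit.QuantumFields.YangMills.Theorems.FemtoTransferGap

end
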